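/-
Copyright: the b2b-balaban T⁴-continuum CRUX team, row NE7b OWNER lineage `t4-ne7b-p1` (gen 119). Project licence.
-/
import Literature.Analysis.Convexity.PrekopaLeindler
import Summits.QuantumFields.BalabanUV.T4Continuum.Spine.NE7b.SupConvexFibreIntegral
import Summits.QuantumFields.BalabanUV.T4Continuum.Spine.NE7b.LogConcaveMarginalGrowth

/-!
# THE INTEGRATED BLOCK-SPIN STEP IS A CLASS OPERATION: for `S` in (110)'s class (modulus `m > 0`), a block map `Qt` with right
# inverse `M` and block Jensen constant `vol`, and ANY injective chart `P` of `ker Qt`, the INTEGRATED effective action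
# `W_int(w) = −log ∫ e^{−S(M w + P z)} dz` obeys the SECANT letter with modulus `m·vol` (Brascamp–Lieb via Prékopa–Leindler on the
# finite carrier `σ → ℝ`); on the TWO-SIDED class it is differentiable ((115)) and obeys the FIRST-ORDER letter with modulus `m·vol`
# and the UPPER letter with modulus `Λ·μ` (`Σ(M k)² ≤ μ·Σ k²`) — the two-sided class `(m, Λ)` is mapped into `(m·vol, Λ·μ)`, so the
# integrated step ITERATES exactly like (110)'s minimising step (row NE7b, node U5c; (115) + (29) + the tree's Prékopa–Leindler BY
# NAME; [cite: BrascampLieb1976, Thm 4.3] for the marginal inequality, everything else [folklore])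

Cell `pub-balaban`, sub-cell `t4`, spine estimate NE7b (`T4WeightBudget.RelWeightBound`; the cell's OWN estimate — NOT PRINTED in
[Bałaban 1983–89], NOT PROVED).  Crux-route work under `Spine/NE7b/` by the row OWNER (`t4-ne7b-p1` gen 119) under FREEZE (0)'s
crux-prover clause, on the OWNER g118's located NEXT item (3)(c) «the measure side: `−log ∫` over the fibre is in the class with
modulus `m·vol` (Brascamp–Lieb)»; NOTHING of Bałaban's is named as a Lean object, valued or asserted; no `T4Continuum/Support` leaf
typed; no `def`, no notation; zero `sorry`.  Imports (BY NAME): the tree's PROVED `Literature.Analysis.Convexity.prekopaLeindler_pi`,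
the OWNER's (115) `…SupConvexFibreIntegral` (`integrable_exp_neg_chart`, `fibreIntegral_pos`, `hasFDerivAt_neg_log_fibreIntegral_chart`,
`integrable_weighted_gradient_chart`; through it (114) `continuous_of_hasFDerivAt`, `continuous_gradient`), the OWNER's (29)
`…LogConcaveMarginalGrowth` (`neg_log_integral_le_of_base_growth` — the growth letter survives a fluctuation integral).

WHY (located).  (110) proved that the MINIMISING step maps the class `(ι, m)` into `(κ, m·vol)`; print's step INTEGRATES the fibre.
Brascamp–Lieb Thm 4.3: the base-direction modulus of a jointly convex exponent survives `−log ∫ e^{−V(w,z)} dz`; along the chart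
`V(w,z) = S(M w + P z)` the joint secant gain `½m·s(1−s)·Σ(M(w₁ − w₀) + P(z₁ − z₀))²` is bounded below, by block Jensen with `Qt∘M = 1`,
`Qt∘P = 0`, by the BASE-direction gain `½(m·vol)·s(1−s)·Σ(w₁ − w₀)²`, so Prékopa–Leindler on `σ → ℝ` (the tree's `prekopaLeindler_pi`,
reindexed along `Fin |σ| ≃ σ`) gives the secant letter of `W_int` on the first-order class alone; the first-order letter follows by
`t ↓ 0` along a segment from (115)'s differentiability, and the upper letter is (29)'s growth transfer.

WHAT IS PROVED ([folklore] unless marked; finite carriers `ι, κ, σ`):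
* §1 **`prekopaLeindler_fintype`** (Prékopa–Leindler on `σ → ℝ` for any `Fintype σ`, `ℝ≥0∞` form, from the tree's `Fin n` version by
  the measure-preserving reindexing `MeasurableEquiv.piCongrLeft`). [cite: BrascampLieb1976, Thm 3.3]
* §2 (the first-order class, `m ≥ 0`) `secant_of_firstOrder` (the letter ⟹ the secant inequality with gain `½m·s(1−s)·Σ(ψ − φ)²`),
  `chart_secant` (along the chart the gain is `≥ ½(m·vol)s(1−s)Σ(w₁ − w₀)²`), **`lintegral_chart_marginal_le`** (the two-point
  marginal inequality `Z(w₀)^{1−s}Z(w₁)^s ≤ e^{−c}Z(w_s)`, `c = ½(m·vol)s(1−s)Σ(w₁ − w₀)²`) [cite: BrascampLieb1976, Thm 4.3],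
  **`negLog_chart_secant`** (`m > 0`, `p > 0`: THE SECANT LETTER OF `W_int` WITH MODULUS `m·vol`, every `s ∈ [0,1]`).
* §3 `firstOrder_of_secant_hasFDerivAt` (secant letter on `(0,1)` + `HasFDerivAt` at the base point ⟹ first-order letter, `Σ`-currency),
  **`integratedStep_firstOrder`** (two-sided class: `W_int w + W_int′w(w′ − w) + ½(m·vol)Σ(w′ − w)² ≤ W_int w′`, `W_int′` = (115)'s tilted
  mean).
* §4 **`integratedStep_upper`** (two-sided class, `Σ(M k)² ≤ μΣ k²`: `W_int w′ ≤ W_int w + W_int′w(w′ − w) + ½(Λ·μ)Σ(w′ − w)²`).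
* §5 **`integratedStep_closure`** (assembled: `∃ W′`, `HasFDerivAt` everywhere + lower letter `m·vol` + upper letter `Λ·μ` — the
  integrated step maps the two-sided class `(ι; m, Λ)` into `(κ; m·vol, Λ·μ)` and therefore ITERATES along any tower of block maps).
* §6 toy.

HONEST (what this is NOT).  The marginal inequality is Brascamp–Lieb's by name (tree-proved Prékopa–Leindler); the rest is
finite-dimensional calculus.  Two-sided class only for the `C¹` half (`φ⁴` excluded there; the SECANT letter §2 holds on the one-sided
class); no normalisation of `dz` is fixed (the chart's Jacobian adds a `w`-independent constant to `W_int`, invisible to the letters);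
no semigroup law for the integrated step typed here (Fubini along composite charts — located, not done); no locality; constants
`m·vol`, `Λ·μ` only; nothing about which block maps ∕ charts print uses; cubic periods; scalar skeleton, hard constraint ((A3),
NC-NE7b-α UNRULED); nothing of Bałaban's.  BY-NAME EFFECT ON THE WALL: NONE.  NE7b NOT PRINTED ∕ NOT PROVED; spine PROVED 0∕9; rung
(B)+1 on a FINITE torus — NOT infinite volume, NOT the mass gap, NOT Clay.  HONEST DEPENDENCY: continuum YM on T⁴ ⇐ BetaPertH ∧ nine
spine estimates (0∕9 proved); BetaPertH ⇐ (D1) ∧ (D4) ∧ CAP+tail; G-an2-4 gates asym, D1 and NE2∕3∕4.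
-/

set_option autoImplicit false

noncomputable section

namespace Summit.QuantumFields.BalabanUV.T4Continuum.NE7b.SupConvexStepIntegrated

open Set Function Filter Metric MeasureTheory Real
open scoped Topology ENNReal
open SupConvexClassEnvelope (continuous_of_hasFDerivAt)
open SupConvexFibreIntegral (continuous_gradient_comp_chart integrable_exp_neg_chart fibreIntegral_pos
  hasFDerivAt_neg_log_fibreIntegral_chart integrable_weighted_gradient_chart)
open LogConcaveMarginalGrowth (neg_log_integral_le_of_base_growth)

/-! ## §1. Prékopa–Leindler on a finite carrier `σ → ℝ` -/

section PL

variable {σ : Type*} [Fintype σ]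

/-- **PRÉKOPA–LEINDLER ON `σ → ℝ`** (`ℝ≥0∞` form, product Lebesgue measure, ANY finite index type): `f, g, h` measurable,
`0 < s < 1`, `f(x)^{1−s} g(y)^s ≤ h((1−s)x + s y)` ⟹ `(∫ f)^{1−s}(∫ g)^s ≤ ∫ h` — the tree's `prekopaLeindler_pi` (on `Fin n → ℝ`)
transported along the measure-preserving linear reindexing `Fin |σ| ≃ σ`. [cite: BrascampLieb1976, Thm 3.3] -/
theorem prekopaLeindler_fintype {s : ℝ} (hs0 : 0 < s) (hs1 : s < 1) {f g h : (σ → ℝ) → ℝ≥0∞}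
    (hf : Measurable f) (hg : Measurable g) (hh : Measurable h)
    (H : ∀ x y, f x ^ (1 - s) * g y ^ s ≤ h ((1 - s) • x + s • y)) :
    (∫⁻ x, f x) ^ (1 - s) * (∫⁻ y, g y) ^ s ≤ ∫⁻ z, h z := by
  classical
  set eσ : Fin (Fintype.card σ) ≃ σ := (Fintype.equivFin σ).symm
  set e : (Fin (Fintype.card σ) → ℝ) ≃ᵐ (σ → ℝ) := MeasurableEquiv.piCongrLeft (fun _ : σ => ℝ) eσ with he
  have hmp : MeasurePreserving e volume volume := volume_measurePreserving_piCongrLeft (fun _ : σ => ℝ) eσ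
  have happly : ∀ (x : Fin (Fintype.card σ) → ℝ) (b : σ), e x b = x (eσ.symm b) := fun x b => by
    have := MeasurableEquiv.piCongrLeft_apply_apply eσ (β := fun _ : σ => ℝ) x (eσ.symm b)
    rw [Equiv.apply_symm_apply] at this
    rw [he]
    exact this
  have hlin : ∀ (a b : ℝ) (x y : Fin (Fintype.card σ) → ℝ), e (a • x + b • y) = a • e x + b • e y :=
    fun a b x y => by funext i; simp only [happly, Pi.add_apply, Pi.smul_apply, smul_eq_mul]
  rw [← hmp.lintegral_comp hf, ← hmp.lintegral_comp hg, ← hmp.lintegral_comp hh]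
  refine Literature.Analysis.Convexity.prekopaLeindler_pi hs0 hs1 (Fintype.card σ) (hf.comp hmp.measurable)
    (hg.comp hmp.measurable) (hh.comp hmp.measurable) fun x y => ?_
  simp only [hlin]
  exact H _ _

end PL

/-! ## §2. The Brascamp–Lieb secant letter of the integrated effective action -/

section Secant

variable {ι κ σ : Type*} [Fintype ι] [Fintype κ] [Fintype σ]
  {S : (ι → ℝ) → ℝ} {S' : (ι → ℝ) → (ι → ℝ) →L[ℝ] ℝ} {m vol p : ℝ}
  (Qt : (ι → ℝ) →L[ℝ] (κ → ℝ)) (M : (κ → ℝ) →L[ℝ] (ι → ℝ)) (P : (σ → ℝ) →L[ℝ] (ι → ℝ))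

omit [Fintype κ] [Fintype σ] in
/-- **THE FIRST-ORDER LETTER IS A SECANT LETTER** (`m ≥ 0`): for `0 ≤ s ≤ 1`,
`S((1−s)φ + sψ) + ½m·s(1−s)·Σ(ψ − φ)² ≤ (1−s)S φ + s S ψ` (the letter at the interpolant towards both endpoints). [folklore] -/
theorem secant_of_firstOrder (hlo : ∀ φ ψ : ι → ℝ, S φ + S' φ (ψ - φ) + m / 2 * ∑ x, (ψ x - φ x) ^ 2 ≤ S ψ)
    (φ ψ : ι → ℝ) {s : ℝ} (hs0 : 0 ≤ s) (hs1 : s ≤ 1) :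
    S ((1 - s) • φ + s • ψ) + m / 2 * s * (1 - s) * ∑ x, (ψ x - φ x) ^ 2 ≤ (1 - s) * S φ + s * S ψ := by
  set ξ : ι → ℝ := (1 - s) • φ + s • ψ with hξ
  have e1 : φ - ξ = s • (φ - ψ) := by
    funext x; simp only [hξ, Pi.sub_apply, Pi.add_apply, Pi.smul_apply, smul_eq_mul]; ring
  have e2 : ψ - ξ = (1 - s) • (ψ - φ) := by
    funext x; simp only [hξ, Pi.sub_apply, Pi.add_apply, Pi.smul_apply, smul_eq_mul]; ring
  have hsq : ∀ (c : ℝ) (u : ι → ℝ), ∑ x, (c • u) x ^ 2 = c ^ 2 * ∑ x, u x ^ 2 := fun c u => by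
    rw [Finset.mul_sum]; exact Finset.sum_congr rfl fun x _ => by simp only [Pi.smul_apply, smul_eq_mul]; ring
  have h1 := hlo ξ φ
  have h2 := hlo ξ ψ
  rw [show (∑ x, (φ x - ξ x) ^ 2) = ∑ x, (φ - ξ) x ^ 2 from rfl, e1, map_smul, hsq] at h1
  rw [show (∑ x, (ψ x - ξ x) ^ 2) = ∑ x, (ψ - ξ) x ^ 2 from rfl, e2, map_smul, hsq,
    show S' ξ (ψ - φ) = -S' ξ (φ - ψ) by rw [← map_neg, neg_sub]] at h2
  have hsym : ∑ x, (φ x - ψ x) ^ 2 = ∑ x, (ψ x - φ x) ^ 2 := Finset.sum_congr rfl fun x _ => by ring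
  simp only [smul_eq_mul, Pi.sub_apply] at h1 h2
  rw [hsym] at h1
  have k := add_le_add (mul_le_mul_of_nonneg_left h1 (sub_nonneg.2 hs1)) (mul_le_mul_of_nonneg_left h2 hs0)
  have e : (1 - s) * (S ξ + s * S' ξ (φ - ψ) + m / 2 * (s ^ 2 * ∑ x, (ψ x - φ x) ^ 2)) +
      s * (S ξ + (1 - s) * -(S' ξ (φ - ψ)) + m / 2 * ((1 - s) ^ 2 * ∑ x, (ψ x - φ x) ^ 2)) =
      S ξ + m / 2 * s * (1 - s) * ∑ x, (ψ x - φ x) ^ 2 := by ring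
  linarith

omit [Fintype σ] in
/-- **ALONG THE CHART THE GAIN IS A BASE-DIRECTION MODULUS** (`m ≥ 0`, `Qt∘M = 1`, `Qt∘P = 0`, block Jensen `vol·Σ(Qt h)² ≤ Σ h²`):
for `ψᵢ = M wᵢ + P zᵢ` and `0 ≤ s ≤ 1`,
`S(M w_s + P z_s) + ½(m·vol)s(1−s)Σ(w₁ − w₀)² ≤ (1−s)S ψ₀ + s S ψ₁` (`w_s, z_s` the interpolants). [folklore] -/
theorem chart_secant (hlo : ∀ φ ψ : ι → ℝ, S φ + S' φ (ψ - φ) + m / 2 * ∑ x, (ψ x - φ x) ^ 2 ≤ S ψ) (hm : 0 ≤ m)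
    (hQM : ∀ k : κ → ℝ, Qt (M k) = k) (hQP : ∀ z : σ → ℝ, Qt (P z) = 0)
    (hJ : ∀ h : ι → ℝ, vol * ∑ y, Qt h y ^ 2 ≤ ∑ x, h x ^ 2)
    (w₀ w₁ : κ → ℝ) (z₀ z₁ : σ → ℝ) {s : ℝ} (hs0 : 0 ≤ s) (hs1 : s ≤ 1) :
    S (M ((1 - s) • w₀ + s • w₁) + P ((1 - s) • z₀ + s • z₁)) + m * vol / 2 * s * (1 - s) * ∑ y, (w₁ y - w₀ y) ^ 2
      ≤ (1 - s) * S (M w₀ + P z₀) + s * S (M w₁ + P z₁) := by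
  have h := secant_of_firstOrder hlo (M w₀ + P z₀) (M w₁ + P z₁) hs0 hs1
  have e : (1 - s) • (M w₀ + P z₀) + s • (M w₁ + P z₁) = M ((1 - s) • w₀ + s • w₁) + P ((1 - s) • z₀ + s • z₁) := by
    simp only [map_add, map_smul, smul_add]; abel
  rw [e] at h
  have hJ' := hJ ((M w₁ + P z₁) - (M w₀ + P z₀))
  have hQ : Qt ((M w₁ + P z₁) - (M w₀ + P z₀)) = w₁ - w₀ := by
    rw [map_sub, map_add, map_add, hQM, hQM, hQP, hQP, add_zero, add_zero]
  rw [hQ] at hJ'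
  simp only [Pi.sub_apply] at hJ'
  have hss : 0 ≤ m / 2 * s * (1 - s) := by
    have : 0 ≤ 1 - s := sub_nonneg.2 hs1
    positivity
  have := mul_le_mul_of_nonneg_left hJ' hss
  linarith

/-- **THE TWO-POINT MARGINAL INEQUALITY ALONG THE CHART** (`m ≥ 0`, `0 < s < 1`; `ℝ≥0∞` form): with
`Z(w) = ∫ e^{−S(M w + P z)} dz` and `c = ½(m·vol)s(1−s)Σ(w₁ − w₀)²`, `Z(w₀)^{1−s}·Z(w₁)^s ≤ e^{−c}·Z((1−s)w₀ + s w₁)`.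
[cite: BrascampLieb1976, Thm 4.3] -/
theorem lintegral_chart_marginal_le (hS : ∀ φ, HasFDerivAt S (S' φ) φ)
    (hlo : ∀ φ ψ : ι → ℝ, S φ + S' φ (ψ - φ) + m / 2 * ∑ x, (ψ x - φ x) ^ 2 ≤ S ψ) (hm : 0 ≤ m)
    (hQM : ∀ k : κ → ℝ, Qt (M k) = k) (hQP : ∀ z : σ → ℝ, Qt (P z) = 0)
    (hJ : ∀ h : ι → ℝ, vol * ∑ y, Qt h y ^ 2 ≤ ∑ x, h x ^ 2) (w₀ w₁ : κ → ℝ) {s : ℝ} (hs0 : 0 < s) (hs1 : s < 1) :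
    (∫⁻ z : σ → ℝ, ENNReal.ofReal (exp (-S (M w₀ + P z)))) ^ (1 - s) *
        (∫⁻ z : σ → ℝ, ENNReal.ofReal (exp (-S (M w₁ + P z)))) ^ s ≤
      ENNReal.ofReal (exp (-(m * vol / 2 * s * (1 - s) * ∑ y, (w₁ y - w₀ y) ^ 2))) *
        ∫⁻ z : σ → ℝ, ENNReal.ofReal (exp (-S (M ((1 - s) • w₀ + s • w₁) + P z))) := by
  have hcont : Continuous S := continuous_of_hasFDerivAt hS
  have hVm : ∀ w : κ → ℝ, Measurable fun z : σ → ℝ => ENNReal.ofReal (exp (-S (M w + P z))) := fun w =>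
    (continuous_exp.comp ((hcont.comp ((continuous_const (y := M w)).add P.continuous)).neg)).measurable.ennreal_ofReal
  set c : ℝ := m * vol / 2 * s * (1 - s) * ∑ y, (w₁ y - w₀ y) ^ 2 with hc
  have h1s : 0 < 1 - s := by linarith
  rw [← lintegral_const_mul _ (hVm _)]
  refine prekopaLeindler_fintype hs0 hs1 (hVm w₀) (hVm w₁) ((hVm _).const_mul _) fun z₀ z₁ => ?_
  rw [ENNReal.ofReal_rpow_of_nonneg (exp_pos _).le h1s.le, ENNReal.ofReal_rpow_of_nonneg (exp_pos _).le hs0.le,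
    ← ENNReal.ofReal_mul (rpow_nonneg (exp_pos _).le _), ← ENNReal.ofReal_mul (exp_pos _).le,
    ← exp_mul, ← exp_mul, ← exp_add, ← exp_add]
  refine ENNReal.ofReal_le_ofReal (exp_le_exp.2 ?_)
  have key := chart_secant Qt M P hlo hm hQM hQP hJ w₀ w₁ z₀ z₁ hs0.le hs1.le
  rw [← hc] at key
  linarith

omit [Fintype κ] in
/-- The fibre integral in `ℝ≥0∞` form is `ofReal` of the Bochner integral (the density is integrable and positive). [folklore] -/
theorem lintegral_chart_eq_ofReal (hS : ∀ φ, HasFDerivAt S (S' φ) φ)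
    (hlo : ∀ φ ψ : ι → ℝ, S φ + S' φ (ψ - φ) + m / 2 * ∑ x, (ψ x - φ x) ^ 2 ≤ S ψ) (hm : 0 < m)
    (hP : ∀ z : σ → ℝ, p * ∑ i, z i ^ 2 ≤ ∑ x, P z x ^ 2) (hp : 0 < p) (w : κ → ℝ) :
    ∫⁻ z : σ → ℝ, ENNReal.ofReal (exp (-S (M w + P z))) = ENNReal.ofReal (∫ z : σ → ℝ, exp (-S (M w + P z))) :=
  (ofReal_integral_eq_lintegral_ofReal (integrable_exp_neg_chart M P hS hlo hm hP hp w)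
    (Eventually.of_forall fun _ => (exp_pos _).le)).symm

/-- **THE SECANT LETTER OF THE INTEGRATED EFFECTIVE ACTION, MODULUS `m·vol`** (the first-order class with `m > 0`; `Qt∘M = 1`,
`Qt∘P = 0`, block Jensen `vol`; chart `p·Σ z² ≤ Σ(P z)²`, `p > 0`): for all base points `w₀, w₁` and `0 ≤ s ≤ 1`,
`W_int((1−s)w₀ + s w₁) + ½(m·vol)s(1−s)Σ(w₁ − w₀)² ≤ (1−s)W_int(w₀) + s W_int(w₁)`, `W_int(w) = −log ∫ e^{−S(M w + P z)} dz`.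
[cite: BrascampLieb1976, Thm 4.3] -/
theorem negLog_chart_secant (hS : ∀ φ, HasFDerivAt S (S' φ) φ)
    (hlo : ∀ φ ψ : ι → ℝ, S φ + S' φ (ψ - φ) + m / 2 * ∑ x, (ψ x - φ x) ^ 2 ≤ S ψ) (hm : 0 < m)
    (hQM : ∀ k : κ → ℝ, Qt (M k) = k) (hQP : ∀ z : σ → ℝ, Qt (P z) = 0)
    (hJ : ∀ h : ι → ℝ, vol * ∑ y, Qt h y ^ 2 ≤ ∑ x, h x ^ 2)
    (hP : ∀ z : σ → ℝ, p * ∑ i, z i ^ 2 ≤ ∑ x, P z x ^ 2) (hp : 0 < p) (w₀ w₁ : κ → ℝ) {s : ℝ} (hs0 : 0 ≤ s) (hs1 : s ≤ 1) :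
    -log (∫ z : σ → ℝ, exp (-S (M ((1 - s) • w₀ + s • w₁) + P z)))
        + m * vol / 2 * s * (1 - s) * ∑ y, (w₁ y - w₀ y) ^ 2 ≤
      (1 - s) * -log (∫ z : σ → ℝ, exp (-S (M w₀ + P z))) + s * -log (∫ z : σ → ℝ, exp (-S (M w₁ + P z))) := by
  rcases hs0.eq_or_lt with rfl | hs0'
  · simp
  rcases hs1.eq_or_lt' with rfl | hs1'
  · simp
  have h1s : 0 < 1 - s := by linarith
  set c : ℝ := m * vol / 2 * s * (1 - s) * ∑ y, (w₁ y - w₀ y) ^ 2 with hc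
  have hZ := fun w => fibreIntegral_pos M P hS hlo hm hP hp w
  have key := lintegral_chart_marginal_le Qt M P hS hlo hm.le hQM hQP hJ w₀ w₁ hs0' hs1'
  rw [lintegral_chart_eq_ofReal M P hS hlo hm hP hp, lintegral_chart_eq_ofReal M P hS hlo hm hP hp,
    lintegral_chart_eq_ofReal M P hS hlo hm hP hp, ENNReal.ofReal_rpow_of_nonneg (hZ w₀).le h1s.le,
    ENNReal.ofReal_rpow_of_nonneg (hZ w₁).le hs0'.le, ← ENNReal.ofReal_mul (rpow_nonneg (hZ w₀).le _),
    ← ENNReal.ofReal_mul (exp_pos _).le, ENNReal.ofReal_le_ofReal_iff (mul_nonneg (exp_pos _).le (hZ _).le)] at key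
  -- take logarithms
  have hlog := log_le_log (mul_pos (rpow_pos_of_pos (hZ w₀) _) (rpow_pos_of_pos (hZ w₁) _)) key
  rw [log_mul (rpow_pos_of_pos (hZ w₀) _).ne' (rpow_pos_of_pos (hZ w₁) _).ne', log_rpow (hZ w₀), log_rpow (hZ w₁),
    log_mul (exp_pos _).ne' (hZ _).ne', log_exp] at hlog
  rw [hc]
  linarith

end Secant

/-! ## §3. The first-order letter of the integrated step (two-sided class) -/

section FirstOrder

variable {ι κ σ : Type*} [Fintype ι] [Fintype κ] [Fintype σ]
  {S : (ι → ℝ) → ℝ} {S' : (ι → ℝ) → (ι → ℝ) →L[ℝ] ℝ} {m Λ vol p : ℝ}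
  (Qt : (ι → ℝ) →L[ℝ] (κ → ℝ)) (M : (κ → ℝ) →L[ℝ] (ι → ℝ)) (P : (σ → ℝ) →L[ℝ] (ι → ℝ))

omit [Fintype ι] [Fintype σ] in
/-- **SECANT LETTER + DIFFERENTIABILITY AT THE BASE POINT ⟹ FIRST-ORDER LETTER** (`Σ`-currency on a finite carrier): if
`W((1−s)w + s w′) + ½μ·s(1−s)Σ(w′ − w)² ≤ (1−s)W w + s W w′` for `0 < s < 1` and `HasFDerivAt W L w`, then
`W w + L(w′ − w) + ½μ·Σ(w′ − w)² ≤ W w′` (divide by `s`, `s ↓ 0`). [folklore] -/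
theorem firstOrder_of_secant_hasFDerivAt {W : (κ → ℝ) → ℝ} {μ : ℝ} {w w' : κ → ℝ} {L : (κ → ℝ) →L[ℝ] ℝ}
    (hd : HasFDerivAt W L w)
    (hsec : ∀ s : ℝ, 0 < s → s < 1 →
      W ((1 - s) • w + s • w') + μ / 2 * s * (1 - s) * ∑ y, (w' y - w y) ^ 2 ≤ (1 - s) * W w + s * W w') :
    W w + L (w' - w) + μ / 2 * ∑ y, (w' y - w y) ^ 2 ≤ W w' := by
  set R : ℝ := ∑ y, (w' y - w y) ^ 2
  have hline : HasDerivAt (fun t : ℝ => w + t • (w' - w)) (w' - w) 0 := by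
    simpa using HasDerivAt.const_add w (HasDerivAt.smul_const (hasDerivAt_id (0 : ℝ)) (w' - w))
  have hd0 : HasFDerivAt W L ((fun t : ℝ => w + t • (w' - w)) 0) := by simpa using hd
  have hslope := (HasFDerivAt.comp_hasDerivAt (0 : ℝ) hd0 hline).tendsto_slope_zero_right
  have hev : ∀ᶠ t in nhdsWithin (0 : ℝ) (Set.Ioi 0),
      t⁻¹ • ((W ∘ fun t : ℝ => w + t • (w' - w)) (0 + t) - (W ∘ fun t : ℝ => w + t • (w' - w)) 0) ≤
        W w' - W w - (1 - t) * (μ / 2 * R) := by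
    filter_upwards [Ioo_mem_nhdsGT (zero_lt_one' ℝ)] with t ht
    have h := hsec t ht.1 ht.2
    rw [show (1 - t) • w + t • w' = w + t • (w' - w) by rw [sub_smul, one_smul, smul_sub]; abel] at h
    simp only [Function.comp_apply, zero_add, zero_smul, add_zero, smul_eq_mul]
    rw [inv_mul_le_iff₀ ht.1]
    nlinarith [h, ht.1]
  have hrhs : Tendsto (fun t : ℝ => W w' - W w - (1 - t) * (μ / 2 * R)) (nhdsWithin (0 : ℝ) (Set.Ioi 0))
      (𝓝 (W w' - W w - (1 - 0) * (μ / 2 * R))) :=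
    ((continuous_const.sub ((continuous_const.sub continuous_id).mul continuous_const)).tendsto 0).mono_left
      nhdsWithin_le_nhds
  have key := le_of_tendsto_of_tendsto hslope hrhs hev
  linarith

/-- **THE FIRST-ORDER LETTER OF THE INTEGRATED STEP, MODULUS `m·vol`** (two-sided class `m > 0`, `Λ ≥ 0`; `Qt∘M = 1`, `Qt∘P = 0`,
block Jensen `vol`; chart `p > 0`): with `W_int(w) = −log ∫ e^{−S(M w + P z)} dz` and `W_int′(w)` (115)'s tilted mean of
`(S′(M w + P z))∘M`, for all `w, w′`: `W_int w + W_int′w(w′ − w) + ½(m·vol)Σ(w′ − w)² ≤ W_int w′`. [folklore] -/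
theorem integratedStep_firstOrder (hS : ∀ φ, HasFDerivAt S (S' φ) φ)
    (hlo : ∀ φ ψ : ι → ℝ, S φ + S' φ (ψ - φ) + m / 2 * ∑ x, (ψ x - φ x) ^ 2 ≤ S ψ) (hm : 0 < m)
    (hup : ∀ φ ψ : ι → ℝ, S ψ ≤ S φ + S' φ (ψ - φ) + Λ / 2 * ∑ x, (ψ x - φ x) ^ 2) (hΛ : 0 ≤ Λ)
    (hQM : ∀ k : κ → ℝ, Qt (M k) = k) (hQP : ∀ z : σ → ℝ, Qt (P z) = 0)
    (hJ : ∀ h : ι → ℝ, vol * ∑ y, Qt h y ^ 2 ≤ ∑ x, h x ^ 2)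
    (hP : ∀ z : σ → ℝ, p * ∑ i, z i ^ 2 ≤ ∑ x, P z x ^ 2) (hp : 0 < p) (w w' : κ → ℝ) :
    -log (∫ z : σ → ℝ, exp (-S (M w + P z)))
        + ((∫ z : σ → ℝ, exp (-S (M w + P z)))⁻¹ •
            ∫ z : σ → ℝ, exp (-S (M w + P z)) • (S' (M w + P z)).comp M) (w' - w)
        + m * vol / 2 * ∑ y, (w' y - w y) ^ 2 ≤
      -log (∫ z : σ → ℝ, exp (-S (M w' + P z))) := by
  refine firstOrder_of_secant_hasFDerivAt (W := fun w : κ → ℝ => -log (∫ z : σ → ℝ, exp (-S (M w + P z))))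
    (hasFDerivAt_neg_log_fibreIntegral_chart M P hS hlo hm hup hΛ hP hp w) fun s hs0 hs1 => ?_
  exact negLog_chart_secant Qt M P hS hlo hm hQM hQP hJ hP hp w w' hs0.le hs1.le

end FirstOrder

/-! ## §4. The upper letter of the integrated step (two-sided class) -/

section Upper

variable {ι κ σ : Type*} [Fintype ι] [Fintype κ] [Fintype σ]
  {S : (ι → ℝ) → ℝ} {S' : (ι → ℝ) → (ι → ℝ) →L[ℝ] ℝ} {m Λ μ p : ℝ}
  (M : (κ → ℝ) →L[ℝ] (ι → ℝ)) (P : (σ → ℝ) →L[ℝ] (ι → ℝ))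

/-- **THE UPPER LETTER OF THE INTEGRATED STEP, MODULUS `Λ·μ`** (two-sided class `m > 0`, `Λ ≥ 0`; `Σ(M k)² ≤ μ·Σ k²`; chart
`p > 0`): `W_int w′ ≤ W_int w + W_int′w(w′ − w) + ½(Λ·μ)Σ(w′ − w)²` — (29)'s growth transfer with the fibrewise growth of the upper
letter along `M(w′ − w)`. [folklore] -/
theorem integratedStep_upper (hS : ∀ φ, HasFDerivAt S (S' φ) φ)
    (hlo : ∀ φ ψ : ι → ℝ, S φ + S' φ (ψ - φ) + m / 2 * ∑ x, (ψ x - φ x) ^ 2 ≤ S ψ) (hm : 0 < m)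
    (hup : ∀ φ ψ : ι → ℝ, S ψ ≤ S φ + S' φ (ψ - φ) + Λ / 2 * ∑ x, (ψ x - φ x) ^ 2) (hΛ : 0 ≤ Λ)
    (hμ : ∀ k : κ → ℝ, ∑ x, M k x ^ 2 ≤ μ * ∑ y, k y ^ 2)
    (hP : ∀ z : σ → ℝ, p * ∑ i, z i ^ 2 ≤ ∑ x, P z x ^ 2) (hp : 0 < p) (w w' : κ → ℝ) :
    -log (∫ z : σ → ℝ, exp (-S (M w' + P z))) ≤
      -log (∫ z : σ → ℝ, exp (-S (M w + P z)))
        + ((∫ z : σ → ℝ, exp (-S (M w + P z)))⁻¹ •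
            ∫ z : σ → ℝ, exp (-S (M w + P z)) • (S' (M w + P z)).comp M) (w' - w)
        + Λ * μ / 2 * ∑ y, (w' y - w y) ^ 2 := by
  have hcont : Continuous S := continuous_of_hasFDerivAt hS
  -- the degenerate case `w′ = w`
  by_cases hww : w' = w
  · subst hww
    simp
  have hnorm : 0 < ‖w' - w‖ := norm_pos_iff.2 (sub_ne_zero.2 hww)
  -- the fibrewise growth letter with constant `c = ½Λ·Σ(M(w′ − w))²`, written as `b‖w′ − w‖²`
  set c : ℝ := Λ / 2 * ∑ x, (M (w' - w)) x ^ 2 with hc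
  set b : ℝ := c / ‖w' - w‖ ^ 2 with hb
  have hbc : b * ‖w' - w‖ ^ 2 = c := by
    rw [hb]; field_simp
  have hgrowth : ∀ z : σ → ℝ, S (M w' + P z) ≤ S (M w + P z) + ((S' (M w + P z)).comp M) (w' - w) + b * ‖w' - w‖ ^ 2 := by
    intro z
    have h := hup (M w + P z) (M w' + P z)
    have e : M w' + P z - (M w + P z) = M (w' - w) := by rw [map_sub]; abel
    rw [e] at h
    rw [show (∑ x, ((M w' + P z) x - (M w + P z) x) ^ 2) = ∑ x, (M w' + P z - (M w + P z)) x ^ 2 from rfl, e] at h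
    rw [hbc, hc, ContinuousLinearMap.comp_apply]
    exact h
  have hconv : ∀ φ ψ : ι → ℝ, S φ + S' φ (ψ - φ) ≤ S ψ := fun φ ψ => by
    have := hlo φ ψ
    have : 0 ≤ m / 2 * ∑ x, (ψ x - φ x) ^ 2 := mul_nonneg (by positivity) (Finset.sum_nonneg fun x _ => sq_nonneg _)
    linarith
  have hVc : ∀ v : κ → ℝ, Continuous fun z : σ → ℝ => S (M v + P z) := fun v =>
    hcont.comp ((continuous_const (y := M v)).add P.continuous)
  have key := neg_log_integral_le_of_base_growth (μ := (volume : Measure (σ → ℝ)))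
    (V := fun q : (κ → ℝ) × (σ → ℝ) => S (M q.1 + P q.2))
    (Vx := fun q : (κ → ℝ) × (σ → ℝ) => (S' (M q.1 + P q.2)).comp M) (x₀ := w) (x := w') (b := b)
    (hVc w).aestronglyMeasurable
    (continuous_gradient_comp_chart M P hS hconv w).aestronglyMeasurable
    (integrable_exp_neg_chart M P hS hlo hm hP hp w) (integrable_exp_neg_chart M P hS hlo hm hP hp w')
    (integrable_weighted_gradient_chart M P hS hlo hm hup hΛ hP hp w) (fibreIntegral_pos M P hS hlo hm hP hp w)
    hgrowth
  have hcμ : b * ‖w' - w‖ ^ 2 ≤ Λ * μ / 2 * ∑ y, (w' y - w y) ^ 2 := by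
    rw [hbc, hc]
    have h1 := hμ (w' - w)
    simp only [Pi.sub_apply] at h1
    have := mul_le_mul_of_nonneg_left h1 (by positivity : 0 ≤ Λ / 2)
    linarith
  linarith

end Upper

/-! ## §5. The integrated step maps the two-sided class into itself -/

section Closure

variable {ι κ σ : Type*} [Fintype ι] [Fintype κ] [Fintype σ]
  {S : (ι → ℝ) → ℝ} {S' : (ι → ℝ) → (ι → ℝ) →L[ℝ] ℝ} {m Λ vol μ p : ℝ}
  (Qt : (ι → ℝ) →L[ℝ] (κ → ℝ)) (M : (κ → ℝ) →L[ℝ] (ι → ℝ)) (P : (σ → ℝ) →L[ℝ] (ι → ℝ))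

/-- **THE INTEGRATED STEP IS A CLASS OPERATION, ASSEMBLED**: on the two-sided class `(m, Λ)` (`m > 0`, `Λ ≥ 0`), for a block map `Qt`
with right inverse `M` (`Qt∘M = 1`, `Σ(M k)² ≤ μΣ k²`), block Jensen constant `vol`, and ANY chart `P` of the fluctuation directions
(`Qt∘P = 0`, `p·Σ z² ≤ Σ(P z)²`, `p > 0`), the integrated effective action `W_int(w) = −log ∫ e^{−S(M w + P z)} dz` comes with a
derivative field `W_int′` such that `HasFDerivAt W_int (W_int′ w) w` at every `w`, the lower letter holds with modulus `m·vol` and the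
upper letter with modulus `Λ·μ` — the pair `(W_int, W_int′)` is in the two-sided class `(κ; m·vol, Λ·μ)`, so the step ITERATES.
[folklore] -/
theorem integratedStep_closure (hS : ∀ φ, HasFDerivAt S (S' φ) φ)
    (hlo : ∀ φ ψ : ι → ℝ, S φ + S' φ (ψ - φ) + m / 2 * ∑ x, (ψ x - φ x) ^ 2 ≤ S ψ) (hm : 0 < m)
    (hup : ∀ φ ψ : ι → ℝ, S ψ ≤ S φ + S' φ (ψ - φ) + Λ / 2 * ∑ x, (ψ x - φ x) ^ 2) (hΛ : 0 ≤ Λ)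
    (hQM : ∀ k : κ → ℝ, Qt (M k) = k) (hμ : ∀ k : κ → ℝ, ∑ x, M k x ^ 2 ≤ μ * ∑ y, k y ^ 2)
    (hJ : ∀ h : ι → ℝ, vol * ∑ y, Qt h y ^ 2 ≤ ∑ x, h x ^ 2)
    (hQP : ∀ z : σ → ℝ, Qt (P z) = 0) (hP : ∀ z : σ → ℝ, p * ∑ i, z i ^ 2 ≤ ∑ x, P z x ^ 2) (hp : 0 < p) :
    ∃ W' : (κ → ℝ) → (κ → ℝ) →L[ℝ] ℝ,
      (∀ w, HasFDerivAt (fun w : κ → ℝ => -log (∫ z : σ → ℝ, exp (-S (M w + P z)))) (W' w) w) ∧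
      (∀ w w' : κ → ℝ, -log (∫ z : σ → ℝ, exp (-S (M w + P z))) + W' w (w' - w)
          + m * vol / 2 * ∑ y, (w' y - w y) ^ 2 ≤ -log (∫ z : σ → ℝ, exp (-S (M w' + P z)))) ∧
      ∀ w w' : κ → ℝ, -log (∫ z : σ → ℝ, exp (-S (M w' + P z))) ≤
          -log (∫ z : σ → ℝ, exp (-S (M w + P z))) + W' w (w' - w) + Λ * μ / 2 * ∑ y, (w' y - w y) ^ 2 :=
  ⟨fun w => (∫ z : σ → ℝ, exp (-S (M w + P z)))⁻¹ • ∫ z : σ → ℝ, exp (-S (M w + P z)) • (S' (M w + P z)).comp M,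
    fun w => hasFDerivAt_neg_log_fibreIntegral_chart M P hS hlo hm hup hΛ hP hp w,
    fun w w' => integratedStep_firstOrder Qt M P hS hlo hm hup hΛ hQM hQP hJ hP hp w w',
    fun w w' => integratedStep_upper M P hS hlo hm hup hΛ hμ hP hp w w'⟩

end Closure

/-! ## §6. Toy -/

/-- Toy (§2 `secant_of_firstOrder` with the zero action on one site, `S′ = 0`, modulus `0`, `s = ½`): `0 + 0 ≤ 0`. -/
example (φ ψ : Unit → ℝ) :
    (fun _ : Unit → ℝ => (0 : ℝ)) ((1 - (1 / 2 : ℝ)) • φ + (1 / 2 : ℝ) • ψ)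
        + 0 / 2 * (1 / 2 : ℝ) * (1 - 1 / 2) * ∑ x, (ψ x - φ x) ^ 2 ≤
      (1 - (1 / 2 : ℝ)) * (fun _ : Unit → ℝ => (0 : ℝ)) φ + (1 / 2 : ℝ) * (fun _ : Unit → ℝ => (0 : ℝ)) ψ :=
  secant_of_firstOrder (S := fun _ : Unit → ℝ => (0 : ℝ)) (S' := fun _ => 0) (m := 0) (fun φ ψ => by simp) φ ψ
    (by norm_num) (by norm_num)

end Summit.QuantumFields.BalabanUV.T4Continuum.NE7b.SupConvexStepIntegrated

end
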